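import Mathlib.Combinatorics.SimpleGraph.Clique
import Mathlib.LinearAlgebra.Matrix.Dual
import Mathlib.LinearAlgebra.Dual.Lemmas
import Mathlib.LinearAlgebra.FiniteDimensional.Lemmas
import Mathlib.FieldTheory.Finiteness
import Mathlib.Algebra.Order.BigOperators.Ring.Finset
import Mathlib.Algebra.Field.ZMod
import Mathlib.Tactic.Linarith
import Mathlib.Tactic.Positivity
import Summits.Ventures.DiscreteObjects.UnitDistance.UnitQuadranceF27Hoffman
import HarnessLib

/-!
# The Hoffman ratio bound for Cayley graphs of LINES over `F_p`, by elementary functional kernels (no spectral theory)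

Framing (verbatim for the cell): lottery ticket; floor = certified bounds/negative ranges.

Let `p` be a prime, `V = F_pⁿ` (`Fin n → ZMod p`), and `D ⊆ V` a finite set of non-zero vectors ("directions", `L = |D|`).
Let `G` be any graph on `V` CONTAINING the Cayley graph of the lines spanned by `D`: two distinct NON-adjacent vertices `x, y`
never have `x − y` on a line `F_p · d`, `d ∈ D` (hypothesis `LinesAdj`).  Suppose every non-zero linear functional
`a : V → F_p` (written `x ↦ a ⬝ᵥ x`) kills at least `m` directions: `m ≤ N_D(a) := #{d ∈ D | a ⬝ᵥ d = 0}`.  THEN every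
independent finset `A` of `G` satisfies

  `|A| · (L − m) · p ≤ pⁿ · (L − p·m)`            (`isIndepSet_card_bound_of_lines`, `indepNum_bound_of_lines`).

For the Cayley graph of the `L` punctured lines this is exactly HOFFMAN'S RATIO BOUND `α ≤ |V|·(−λ_min)/(k − λ_min)`: the graph is
`(p−1)L`-regular and its eigenvalue on the character `x ↦ ζ^{a⬝x}` is `p·N_D(a) − L`, so `λ_min = p·m − L` for the best `m`.
The proof here uses no eigenvalues and no characters: for each functional `a` the kernel `k_a(x,y) = p·[a⬝x = a⬝y] − 1` is
positive on finite sets (Cauchy–Schwarz over the `p` fibres, `sum_sum_fiberKernel_nonneg`), the weighted kernel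
`K = Σ_{a ≠ 0} (N_D(a) − m)·k_a` is evaluated by double counting — `#{a | a⬝t = 0} = pⁿ⁻¹` for `t ≠ 0` and
`#{a | a⬝t = a⬝d = 0} = pⁿ⁻²` for `t, d` independent (rank–nullity, `card_filter_eq_zero_mul_pow_of_surjective`) — giving
`K(t) = −(p−1)(L−m)` at every non-zero `t` off the `D`-lines and `p·K(0) = (p−1)(pⁿ(L − p m) − p(L − m))`, and the graph-general
counting lemma `IsIndepSet.card_bound_of_posKernel` of `UnitQuadranceF27Hoffman.lean` finishes.

USE (cell pub-namedobj, target (U), residue-field atlas).  Over `F₃` every symmetric connection set is a union of punctured lines, so the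
theorem applies to every Cayley graph on `F₃ⁿ`; in particular to `UD(F₂₇²) = Cay(F₃⁶, 14 lines)` with `m = 2`: `α·12·3 ≤ 729·8`, i.e.
`α ≤ 162` — the value proved in `UnitQuadranceF27Hoffman.lean` from a 308-entry certificate, here a consequence of a `728 × 14` count
(application file `UnitQuadranceF27HoffmanLines.lean`), and to `UD(F₂₄₃²) = Cay(F₃¹⁰, 122 lines)`.  Seat udg g8 (zero farm).
-/

namespace Summit.Ventures.DiscreteObjects.UnitDistance

open SimpleGraph Finset Module

/-! ## 1. Fibre kernels are positive on sets (Cauchy–Schwarz with `|ι|` terms) -/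

/-- For ANY map `f : V → ι` into a finite type with `q` elements and any finset `A`:
`0 ≤ Σ_{x,y ∈ A} (q·[f x = f y] − 1)`; indeed the sum is `q Σ_c n_c² − (Σ_c n_c)²` with `n_c = |A ∩ f⁻¹(c)|`. -/
theorem sum_sum_fiberKernel_nonneg {V ι : Type*} [Fintype ι] [DecidableEq ι] (A : Finset V) (f : V → ι) :
    0 ≤ ∑ x ∈ A, ∑ y ∈ A, ((Fintype.card ι : ℤ) * (if f x = f y then 1 else 0) - 1) := by
  set nn : ι → ℤ := fun c => ((#{x ∈ A | f x = c} : ℕ) : ℤ) with hnn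
  have hinner : ∀ x ∈ A, ∑ y ∈ A, (if f x = f y then (1 : ℤ) else 0) = nn (f x) := by
    intro x _
    rw [Finset.sum_boole, hnn]
    simp only
    congr 2
    ext y
    simp only [Finset.mem_filter, eq_comm]
  have h1 : ∑ x ∈ A, ∑ y ∈ A, (if f x = f y then (1 : ℤ) else 0) = ∑ c, nn c * nn c := by
    rw [Finset.sum_congr rfl hinner, ← Finset.sum_fiberwise A f fun x => nn (f x)]
    refine Finset.sum_congr rfl fun c _ => ?_
    rw [Finset.sum_congr rfl fun x hx => by rw [(Finset.mem_filter.mp hx).2], Finset.sum_const, nsmul_eq_mul]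
  have h2 : ((#A : ℕ) : ℤ) = ∑ c, nn c := by
    rw [Finset.card_eq_sum_card_fiberwise (f := f) (s := A) (t := univ) fun _ _ => Finset.mem_coe.mpr (Finset.mem_univ _)]
    push_cast
    rfl
  have hcs := Finset.sum_mul_sq_le_sq_mul_sq (univ : Finset ι) nn fun _ => (1 : ℤ)
  simp only [mul_one, Finset.sum_const, Finset.card_univ, nsmul_eq_mul, sq] at hcs
  have hsplit : ∑ x ∈ A, ∑ y ∈ A, ((Fintype.card ι : ℤ) * (if f x = f y then 1 else 0) - 1)
      = (Fintype.card ι : ℤ) * ∑ x ∈ A, ∑ y ∈ A, (if f x = f y then (1 : ℤ) else 0) - (#A : ℤ) * #A := by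
    simp only [Finset.sum_sub_distrib, Finset.sum_const, nsmul_eq_mul, mul_one, ← Finset.mul_sum]
  rw [hsplit, h1, h2]
  linarith

/-! ## 2. Counting functionals on `F_pⁿ` (rank–nullity) -/

section Counting

variable {p : ℕ} [Fact p.Prime] {n : ℕ}

/-- For a SURJECTIVE linear map `f : F_pⁿ → W`: `#{a | f a = 0} · p^{dim W} = pⁿ`. -/
theorem card_filter_eq_zero_mul_pow_of_surjective {W : Type*} [AddCommGroup W] [Module (ZMod p) W]
    [FiniteDimensional (ZMod p) W] [DecidableEq W] (f : (Fin n → ZMod p) →ₗ[ZMod p] W) (hf : Function.Surjective f) :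
    #{a : Fin n → ZMod p | f a = 0} * p ^ finrank (ZMod p) W = p ^ n := by
  classical
  have hker : #{a : Fin n → ZMod p | f a = 0} = p ^ finrank (ZMod p) (LinearMap.ker f) := by
    have h := Module.card_eq_pow_finrank (K := ZMod p) (V := LinearMap.ker f)
    rw [ZMod.card] at h
    rw [← h]
    exact (Fintype.card_of_subtype _ fun a => by simp [LinearMap.mem_ker]).symm
  have hrange : finrank (ZMod p) (LinearMap.range f) = finrank (ZMod p) W := by
    rw [LinearMap.range_eq_top.mpr hf, finrank_top]
  have hrn := LinearMap.finrank_range_add_finrank_ker f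
  rw [Module.finrank_fin_fun] at hrn
  rw [hker, ← pow_add, ← hrange, add_comm, hrn]

/-- The functional `a ↦ t ⬝ᵥ a` (`dotProductEquiv (ZMod p) (Fin n) t`) is onto for `t ≠ 0`. -/
theorem dotProductEquiv_surjective {t : Fin n → ZMod p} (ht : t ≠ 0) :
    Function.Surjective (dotProductEquiv (ZMod p) (Fin n) t) := by
  obtain ⟨i, hi⟩ : ∃ i, t i ≠ 0 := by
    by_contra h
    push Not at h
    exact ht (funext h)
  intro c
  refine ⟨Pi.single i ((t i)⁻¹ * c), ?_⟩
  show t ⬝ᵥ Pi.single i ((t i)⁻¹ * c) = c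
  rw [dotProduct_single, mul_inv_cancel_left₀ hi]

/-- If `t` is not on the line `F_p · d`, some vector `u` has `u ⬝ᵥ t = 1` and `u ⬝ᵥ d = 0` (a dual-basis element). -/
theorem exists_dotProduct_eq_one_eq_zero {t d : Fin n → ZMod p} (h : ∀ c : ZMod p, c • d ≠ t) :
    ∃ u : Fin n → ZMod p, u ⬝ᵥ t = 1 ∧ u ⬝ᵥ d = 0 := by
  have ht : t ∉ Submodule.span (ZMod p) ({d} : Set (Fin n → ZMod p)) := by
    rw [Submodule.mem_span_singleton]
    rintro ⟨c, hc⟩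
    exact h c hc
  obtain ⟨g, hgt, hgd⟩ := Submodule.exists_dual_map_eq_bot_of_notMem ht inferInstance
  have hgd0 : g d = 0 := by
    have hmem : g d ∈ (Submodule.span (ZMod p) ({d} : Set (Fin n → ZMod p))).map g :=
      Submodule.mem_map_of_mem (Submodule.mem_span_singleton_self d)
    rw [hgd] at hmem
    exact (Submodule.mem_bot (ZMod p)).mp hmem
  set a := (dotProductEquiv (ZMod p) (Fin n)).symm g with ha
  have hag : ∀ x, a ⬝ᵥ x = g x := fun x => by
    have happ := LinearEquiv.apply_symm_apply (dotProductEquiv (ZMod p) (Fin n)) g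
    exact congrArg (fun φ : Module.Dual (ZMod p) (Fin n → ZMod p) => φ x) happ
  refine ⟨(g t)⁻¹ • a, ?_, ?_⟩
  · rw [smul_dotProduct, hag, smul_eq_mul, inv_mul_cancel₀ hgt]
  · rw [smul_dotProduct, hag, hgd0, smul_zero]

/-- For `t, d` spanning distinct lines, `a ↦ (t ⬝ᵥ a, d ⬝ᵥ a)` is onto `F_p²`. -/
theorem dotProductEquiv_prod_surjective {t d : Fin n → ZMod p} (htd : ∀ c : ZMod p, c • d ≠ t)
    (hdt : ∀ c : ZMod p, c • t ≠ d) :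
    Function.Surjective ((dotProductEquiv (ZMod p) (Fin n) t).prod (dotProductEquiv (ZMod p) (Fin n) d)) := by
  obtain ⟨u, hut, hud⟩ := exists_dotProduct_eq_one_eq_zero htd
  obtain ⟨v, hvd, hvt⟩ := exists_dotProduct_eq_one_eq_zero hdt
  rintro ⟨c₁, c₂⟩
  refine ⟨c₁ • u + c₂ • v, ?_⟩
  rw [LinearMap.prod_apply]
  show (t ⬝ᵥ (c₁ • u + c₂ • v), d ⬝ᵥ (c₁ • u + c₂ • v)) = (c₁, c₂)
  rw [dotProduct_add, dotProduct_smul, dotProduct_smul, dotProduct_add, dotProduct_smul, dotProduct_smul,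
    dotProduct_comm t u, dotProduct_comm t v, dotProduct_comm d u, dotProduct_comm d v, hut, hvt, hud, hvd]
  simp

/-- `#{a | a ⬝ᵥ t = 0} · p = pⁿ` for `t ≠ 0` (a non-zero functional has `pⁿ⁻¹` zeros). -/
theorem card_filter_dotProduct_eq_zero_mul {t : Fin n → ZMod p} (ht : t ≠ 0) :
    #{a : Fin n → ZMod p | a ⬝ᵥ t = 0} * p = p ^ n := by
  have h := card_filter_eq_zero_mul_pow_of_surjective _ (dotProductEquiv_surjective ht)
  rw [Module.finrank_self, pow_one] at h
  have hset : (univ.filter fun a : Fin n → ZMod p => (dotProductEquiv (ZMod p) (Fin n) t) a = 0)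
      = univ.filter fun a : Fin n → ZMod p => a ⬝ᵥ t = 0 := by
    refine Finset.filter_congr fun a _ => ?_
    show t ⬝ᵥ a = 0 ↔ a ⬝ᵥ t = 0
    rw [dotProduct_comm]
  rw [hset] at h
  exact h

/-- `#{a | a ⬝ᵥ t = 0 ∧ a ⬝ᵥ d = 0} · p² = pⁿ` when `t` and `d` span distinct lines (two independent functionals have `pⁿ⁻²` common zeros). -/
theorem card_filter_dotProduct_pair_eq_zero_mul {t d : Fin n → ZMod p} (htd : ∀ c : ZMod p, c • d ≠ t)
    (hdt : ∀ c : ZMod p, c • t ≠ d) :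
    #{a : Fin n → ZMod p | a ⬝ᵥ t = 0 ∧ a ⬝ᵥ d = 0} * p ^ 2 = p ^ n := by
  have h := card_filter_eq_zero_mul_pow_of_surjective _ (dotProductEquiv_prod_surjective htd hdt)
  rw [Module.finrank_prod, Module.finrank_self] at h
  have hset : (univ.filter fun a : Fin n → ZMod p =>
        ((dotProductEquiv (ZMod p) (Fin n) t).prod (dotProductEquiv (ZMod p) (Fin n) d)) a = 0)
      = univ.filter fun a : Fin n → ZMod p => a ⬝ᵥ t = 0 ∧ a ⬝ᵥ d = 0 := by
    refine Finset.filter_congr fun a _ => ?_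
    rw [LinearMap.prod_apply, Prod.mk_eq_zero]
    show t ⬝ᵥ a = 0 ∧ d ⬝ᵥ a = 0 ↔ a ⬝ᵥ t = 0 ∧ a ⬝ᵥ d = 0
    rw [dotProduct_comm t, dotProduct_comm d]
  rw [hset] at h
  exact h

end Counting

/-! ## 3. The weighted functional kernel and its values -/

section Kernel

variable {p : ℕ} [Fact p.Prime] {n : ℕ} (D : Finset (Fin n → ZMod p))

/-- `N_D(a)`: the number of directions `d ∈ D` killed by the functional `a` (`a ⬝ᵥ d = 0`). -/
def killCount (a : Fin n → ZMod p) : ℕ := #{d ∈ D | a ⬝ᵥ d = 0}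

/-- The kernel of one functional as a function of the difference vector: `k_a(t) = p·[a ⬝ᵥ t = 0] − 1`. -/
def fKer (a t : Fin n → ZMod p) : ℤ := (p : ℤ) * (if a ⬝ᵥ t = 0 then 1 else 0) - 1

/-- The weighted kernel `K(t) = Σ_{a ≠ 0} (N_D(a) − m) · k_a(t)`. -/
def lineKernel (m : ℕ) (t : Fin n → ZMod p) : ℤ :=
  ∑ a ∈ (univ : Finset (Fin n → ZMod p)).erase 0, (((killCount D a : ℕ) : ℤ) - m) * fKer a t

/-- `k_a(x − y) = p·[a ⬝ᵥ x = a ⬝ᵥ y] − 1`. -/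
theorem fKer_sub (a x y : Fin n → ZMod p) :
    fKer a (x - y) = (p : ℤ) * (if a ⬝ᵥ x = a ⬝ᵥ y then 1 else 0) - 1 := by
  simp only [fKer, dotProduct_sub, sub_eq_zero]

/-- `k_a(0) = p − 1`. -/
theorem fKer_zero (a : Fin n → ZMod p) : fKer a 0 = (p : ℤ) - 1 := by
  simp [fKer]

/-- `k_0(t) = p − 1` (the zero functional). -/
theorem fKer_zero_left (t : Fin n → ZMod p) : fKer 0 t = (p : ℤ) - 1 := by
  simp [fKer]

/-- `N_D(0) = |D|`. -/
theorem killCount_zero : killCount D 0 = #D := by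
  simp [killCount]

/-- `N_D(a)` as a sum of indicators. -/
theorem killCount_eq_sum (a : Fin n → ZMod p) :
    ((killCount D a : ℕ) : ℤ) = ∑ d ∈ D, (if a ⬝ᵥ d = 0 then (1 : ℤ) else 0) := by
  rw [killCount, Finset.natCast_card_filter]

/-- FIRST MOMENT: `p · Σ_a N_D(a)·k_a(t) = Σ_{d ∈ D} (p²·#{a | a⬝t = 0 ∧ a⬝d = 0} − p·#{a | a⬝d = 0})` (pure rearrangement). -/
theorem sum_killCount_mul_fKer (t : Fin n → ZMod p) :
    (p : ℤ) * ∑ a, ((killCount D a : ℕ) : ℤ) * fKer a t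
      = ∑ d ∈ D, ((p : ℤ) ^ 2 * #{a : Fin n → ZMod p | a ⬝ᵥ t = 0 ∧ a ⬝ᵥ d = 0}
          - (p : ℤ) * #{a : Fin n → ZMod p | a ⬝ᵥ d = 0}) := by
  have hpt : ∀ a : Fin n → ZMod p, ((killCount D a : ℕ) : ℤ) * fKer a t
      = ∑ d ∈ D, ((p : ℤ) * (if a ⬝ᵥ t = 0 ∧ a ⬝ᵥ d = 0 then 1 else 0) - (if a ⬝ᵥ d = 0 then 1 else 0)) := by
    intro a
    rw [killCount_eq_sum, Finset.sum_mul]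
    refine Finset.sum_congr rfl fun d _ => ?_
    unfold fKer
    by_cases h1 : a ⬝ᵥ t = 0 <;> by_cases h2 : a ⬝ᵥ d = 0 <;> simp [h1, h2]
  rw [Finset.sum_congr rfl fun a _ => hpt a, Finset.sum_comm, Finset.mul_sum]
  refine Finset.sum_congr rfl fun d _ => ?_
  rw [Finset.sum_sub_distrib, ← Finset.mul_sum, Finset.sum_boole, Finset.sum_boole]
  ring

/-- ZEROTH MOMENT: `Σ_a k_a(t) = p·#{a | a ⬝ᵥ t = 0} − pⁿ`. -/
theorem sum_fKer (t : Fin n → ZMod p) :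
    ∑ a, fKer a t = (p : ℤ) * #{a : Fin n → ZMod p | a ⬝ᵥ t = 0} - (p : ℤ) ^ n := by
  unfold fKer
  rw [Finset.sum_sub_distrib, ← Finset.mul_sum, Finset.sum_boole, Finset.sum_const, Finset.card_univ, nsmul_eq_mul, mul_one]
  simp [ZMod.card]

/-- `p · Σ_a N_D(a) = |D| · pⁿ` when `0 ∉ D` (each direction is killed by `pⁿ⁻¹` functionals). -/
theorem sum_killCount (hD : ∀ d ∈ D, d ≠ 0) :
    (p : ℤ) * ∑ a, ((killCount D a : ℕ) : ℤ) = #D * (p : ℤ) ^ n := by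
  have h : (p : ℤ) * ∑ a, ((killCount D a : ℕ) : ℤ) = ∑ d ∈ D, (p : ℤ) * #{a : Fin n → ZMod p | a ⬝ᵥ d = 0} := by
    rw [Finset.sum_congr rfl fun a _ => killCount_eq_sum D a, Finset.sum_comm, Finset.mul_sum]
    refine Finset.sum_congr rfl fun d _ => ?_
    rw [Finset.sum_boole]
  rw [h, Finset.sum_congr rfl fun d hd => ?_, Finset.sum_const, nsmul_eq_mul]
  have hc := card_filter_dotProduct_eq_zero_mul (hD d hd)
  rw [mul_comm]
  exact_mod_cast hc

/-- KERNEL VALUE OFF THE LINES: if `t ≠ 0` lies on no line `F_p·d` (`d ∈ D`), then `K(t) = −(p − 1)(|D| − m)` — for every `m`. -/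
theorem lineKernel_generic (m : ℕ) {t : Fin n → ZMod p} (ht : t ≠ 0)
    (hgen : ∀ d ∈ D, (∀ c : ZMod p, c • d ≠ t) ∧ (∀ c : ZMod p, c • t ≠ d)) :
    lineKernel D m t = -(((p : ℤ) - 1) * ((#D : ℤ) - m)) := by
  have hp : (p : ℤ) ≠ 0 := by exact_mod_cast (Fact.out : p.Prime).ne_zero
  -- the full sum over all `a` vanishes
  have hA : (p : ℤ) * ∑ a, ((killCount D a : ℕ) : ℤ) * fKer a t = 0 := by
    rw [sum_killCount_mul_fKer]
    refine Finset.sum_eq_zero fun d hd => ?_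
    have h2 := card_filter_dotProduct_pair_eq_zero_mul (hgen d hd).1 (hgen d hd).2
    have h1 := card_filter_dotProduct_eq_zero_mul (t := d) (by
      rintro rfl
      exact (hgen 0 hd).2 0 (zero_smul _ _))
    have h2' : ((p : ℤ) ^ 2) * #{a : Fin n → ZMod p | a ⬝ᵥ t = 0 ∧ a ⬝ᵥ d = 0} = (p : ℤ) ^ n := by
      rw [mul_comm]; exact_mod_cast h2
    have h1' : (p : ℤ) * #{a : Fin n → ZMod p | a ⬝ᵥ d = 0} = (p : ℤ) ^ n := by
      rw [mul_comm]; exact_mod_cast h1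
    rw [h2', h1', sub_self]
  have hA' : ∑ a, ((killCount D a : ℕ) : ℤ) * fKer a t = 0 := by
    rcases mul_eq_zero.mp hA with h | h
    · exact absurd h hp
    · exact h
  have hB : ∑ a, fKer a t = 0 := by
    rw [sum_fKer]
    have h1 := card_filter_dotProduct_eq_zero_mul ht
    have h1' : (p : ℤ) * #{a : Fin n → ZMod p | a ⬝ᵥ t = 0} = (p : ℤ) ^ n := by
      rw [mul_comm]; exact_mod_cast h1
    rw [h1', sub_self]
  have hall : ∑ a, (((killCount D a : ℕ) : ℤ) - m) * fKer a t = 0 := by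
    simp only [sub_mul, Finset.sum_sub_distrib, hA', ← Finset.mul_sum, hB, mul_zero, sub_zero]
  unfold lineKernel
  rw [Finset.sum_erase_eq_sub (Finset.mem_univ _), hall, killCount_zero, fKer_zero_left]
  ring

/-- KERNEL VALUE AT ZERO: `p · K(0) = (p − 1)·(pⁿ(|D| − p m) − p(|D| − m))` when `0 ∉ D`. -/
theorem lineKernel_zero (m : ℕ) (hD : ∀ d ∈ D, d ≠ 0) :
    (p : ℤ) * lineKernel D m 0 = ((p : ℤ) - 1) * ((p : ℤ) ^ n * ((#D : ℤ) - p * m) - p * ((#D : ℤ) - m)) := by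
  have hall : (p : ℤ) * ∑ a, (((killCount D a : ℕ) : ℤ) - m) * fKer a 0
      = ((p : ℤ) - 1) * ((p : ℤ) ^ n * ((#D : ℤ) - p * m)) := by
    simp only [fKer_zero]
    rw [← Finset.sum_mul, Finset.sum_sub_distrib, Finset.sum_const, Finset.card_univ, nsmul_eq_mul]
    have hs := sum_killCount D hD
    have hcard : ((Fintype.card (Fin n → ZMod p) : ℕ) : ℤ) = (p : ℤ) ^ n := by
      simp [ZMod.card]
    rw [hcard]
    linear_combination ((p : ℤ) - 1) * hs
  unfold lineKernel
  rw [Finset.sum_erase_eq_sub (Finset.mem_univ _), mul_sub, hall, killCount_zero, fKer_zero_left]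
  ring

/-- POSITIVITY: if every non-zero functional kills at least `m` directions, `K` is positive on finite sets. -/
theorem sum_sum_lineKernel_nonneg (m : ℕ) (hm : ∀ a : Fin n → ZMod p, a ≠ 0 → m ≤ killCount D a)
    (A : Finset (Fin n → ZMod p)) : 0 ≤ ∑ x ∈ A, ∑ y ∈ A, lineKernel D m (x - y) := by
  unfold lineKernel
  set E := (univ : Finset (Fin n → ZMod p)).erase 0 with hE
  have hswap : ∑ x ∈ A, ∑ y ∈ A, ∑ a ∈ E, (((killCount D a : ℕ) : ℤ) - m) * fKer a (x - y)
      = ∑ a ∈ E, (((killCount D a : ℕ) : ℤ) - m) * ∑ x ∈ A, ∑ y ∈ A, fKer a (x - y) := by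
    rw [Finset.sum_congr rfl fun x _ => Finset.sum_comm, Finset.sum_comm]
    refine Finset.sum_congr rfl fun a _ => ?_
    rw [Finset.mul_sum]
    refine Finset.sum_congr rfl fun x _ => ?_
    rw [Finset.mul_sum]
  rw [hswap]
  refine Finset.sum_nonneg fun a ha => mul_nonneg ?_ ?_
  · have h := hm a (Finset.ne_of_mem_erase ha)
    have h' : (m : ℤ) ≤ ((killCount D a : ℕ) : ℤ) := by exact_mod_cast h
    linarith
  · simp only [fKer_sub]
    have h := sum_sum_fiberKernel_nonneg A (fun x => a ⬝ᵥ x)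
    rwa [ZMod.card] at h

end Kernel

/-! ## 4. The bound -/

section Bound

variable {p : ℕ} [Fact p.Prime] {n : ℕ}

/-- HOFFMAN'S RATIO BOUND FOR CAYLEY GRAPHS OF LINES OVER `F_p` (elementary form).  Let `D ⊆ F_pⁿ ∖ {0}` and let `G` be a graph on
`F_pⁿ` in which distinct non-adjacent vertices never differ by a vector on a line `F_p·d`, `d ∈ D`.  If every non-zero functional
kills at least `m` of the directions, then every NON-EMPTY independent finset `A` has `|A|·(|D| − m)·p ≤ pⁿ·(|D| − p·m)`. -/
theorem isIndepSet_card_bound_of_lines (D : Finset (Fin n → ZMod p)) (hD : ∀ d ∈ D, d ≠ 0) (m : ℕ)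
    (hm : ∀ a : Fin n → ZMod p, a ≠ 0 → m ≤ killCount D a) {G : SimpleGraph (Fin n → ZMod p)}
    (hG : ∀ x y, x ≠ y → ¬ G.Adj x y → ∀ d ∈ D, (∀ c : ZMod p, c • d ≠ x - y) ∧ (∀ c : ZMod p, c • (x - y) ≠ d))
    {A : Finset (Fin n → ZMod p)} (hA : G.IsIndepSet (A : Set (Fin n → ZMod p))) (hne : A.Nonempty) :
    (#A : ℤ) * ((#D : ℤ) - m) * p ≤ (p : ℤ) ^ n * ((#D : ℤ) - p * m) := by
  classical
  have hp1 : (1 : ℤ) < p := by exact_mod_cast (Fact.out : p.Prime).one_lt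
  have key := IsIndepSet.card_bound_of_posKernel (G := G) (K := fun x y => lineKernel D m (x - y))
    (c₀ := lineKernel D m 0) (c₁ := ((p : ℤ) - 1) * ((#D : ℤ) - m)) (sum_sum_lineKernel_nonneg D m hm) ?_ ?_ hA
  · have h0 := lineKernel_zero D m hD
    have hApos : (0 : ℤ) < #A := by exact_mod_cast hne.card_pos
    -- `p · key`: (p−1)(L−m)·p·|A|(|A|−1) ≤ (p−1)(pⁿ(L−pm) − p(L−m))·|A|
    have h3 : ((p : ℤ) - 1) * (#A : ℤ) * ((#A : ℤ) * ((#D : ℤ) - m) * p - (p : ℤ) ^ n * ((#D : ℤ) - p * m)) ≤ 0 := by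
      have := mul_le_mul_of_nonneg_left key (show (0 : ℤ) ≤ p by linarith)
      linear_combination this + (#A : ℤ) * h0
    by_contra hc
    push Not at hc
    have hpos : 0 < ((p : ℤ) - 1) * (#A : ℤ) * ((#A : ℤ) * ((#D : ℤ) - m) * p - (p : ℤ) ^ n * ((#D : ℤ) - p * m)) :=
      mul_pos (mul_pos (by linarith) hApos) (by linarith)
    linarith
  · intro x
    simp
  · intro x y hxy hadj
    rw [lineKernel_generic D m (sub_ne_zero.mpr hxy) (hG x y hxy hadj)]

/-- The same bound for the independence number: `α(G)·(|D| − m)·p ≤ pⁿ·(|D| − p·m)`. -/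
theorem indepNum_bound_of_lines (D : Finset (Fin n → ZMod p)) (hD : ∀ d ∈ D, d ≠ 0) (m : ℕ)
    (hm : ∀ a : Fin n → ZMod p, a ≠ 0 → m ≤ killCount D a) {G : SimpleGraph (Fin n → ZMod p)}
    (hG : ∀ x y, x ≠ y → ¬ G.Adj x y → ∀ d ∈ D, (∀ c : ZMod p, c • d ≠ x - y) ∧ (∀ c : ZMod p, c • (x - y) ≠ d)) :
    (G.indepNum : ℤ) * ((#D : ℤ) - m) * p ≤ (p : ℤ) ^ n * ((#D : ℤ) - p * m) := by
  classical
  obtain ⟨s, hs⟩ := G.exists_isNIndepSet_indepNum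
  have hne : s.Nonempty := by
    rw [← Finset.card_pos, hs.card_eq]
    have h1 : G.IsIndepSet (({0} : Finset (Fin n → ZMod p)) : Set (Fin n → ZMod p)) := by
      simp [SimpleGraph.isIndepSet_iff, Set.Pairwise]
    have h2 := h1.card_le_indepNum
    rw [Finset.card_singleton] at h2
    exact h2
  rw [← hs.card_eq]
  exact isIndepSet_card_bound_of_lines D hD m hm hG hs.isIndepSet hne

end Bound

end Summit.Ventures.DiscreteObjects.UnitDistance
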